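import Literature.Analysis.FluidPDE.TaoFiniteEnergyLerayHopf
import Literature.Analysis.FluidPDE.TaoLocalisationProofs
import Literature.Analysis.FluidPDE.TaoLocalisationHolds
import Literature.Analysis.FluidPDE.NSWeakStrongUniquenessHolds
import Literature.Analysis.FluidPDE.NSLerayHopf
import HarnessLib

/-!
# Clay-class solutions are unique within the Leray–Hopf class (Tao 2013, Lemma 8.1 and
# Cor. 11.1, with Prodi–Serrin weak–strong uniqueness) — PROVED

The one rigorous bridge between the Leray–Hopf (non-)uniqueness problem and Fefferman's Clay
statement (A), in the direction "non-uniqueness ⇒ no regular solution", assembled from theorems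
already in the tree.

Let `ν > 0`, let `u₀ : ℝ³ → ℝ³` have rapidly decaying derivatives of all orders (Fefferman (4),
`HasRapidSpatialDecay`), and let `(U, P)` be a solution of the unforced system in the class of
Fefferman's (A): jointly smooth on `[0, ∞) × ℝ³` (`IsSmoothOnHalfSpace`), solving (1)–(3) with
datum `u₀` (`IsNavierStokesSolution ν 0 u₀ U P`), with bounded energy (7) (`HasBoundedEnergy`).
Then:

* `IsNavierStokesSolution.ae_eq_of_isLerayHopfOn` — every Leray–Hopf weak solution `v` on
  `[0, T)` with the same viscosity and datum coincides with `U`: `v(t) = U(t)` a.e. for every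
  `t ∈ (0, T]`. Proof: on the closed slab `[0, T]` the Clay-class solution is a finite energy
  classical solution, hence (Tao 2013, Lemma 8.1 with Lemma 4.1 (i); tree theorem
  `isLerayHopfOn_of_finiteEnergy`) a Leray–Hopf solution from `U 0 = u₀`, and (Tao 2013,
  Cor. 11.1 + Cor. 4.3 + Thm. 5.4 (iv) with the Sobolev imbedding `H² ⊂ L^∞`; tree theorems
  `tao2011_hasBoundedSobolevNormsOn_holds`, `linfty_bound_of_hasBoundedSobolevNormsOn_holds`,
  packaged as `tao2011_hasBoundedSobolevNormsOn.closedSlab`) it lies in `L^∞((0,T); L^∞(ℝ³))`,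
  the endpoint `q = r = ∞` of the Ladyzhenskaya–Prodi–Serrin scale; Prodi–Serrin weak–strong
  uniqueness (ns.S07, tree theorem `weak_strong_uniqueness_holds`) identifies `v` with `U`.
* `not_exists_claySolution_of_lerayHopf_nonunique` — contrapositive: two global Leray–Hopf
  solutions from a rapidly decaying datum `u₀` that differ on a set of positive measure at some
  time `t > 0` exclude the existence of ANY Clay-class solution `(U, P)` from `u₀` at that
  viscosity, i.e. the conclusion of Fefferman's (A) fails for this datum.
* `lerayHopf_unique_of_clayA` — the same against the (A)-shaped hypothesis written out verbatim
  (the summit statement `NavierStokesRegularity := Literature.NS.NavierStokesExistenceSmoothR3`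
  lives under `Summits/` and is not importable here; instantiating `hA := NavierStokesRegularity`
  summit-side is a one-line application): under (A), Leray–Hopf solutions from Clay data are
  unique for all positive times.

## Why this file exists (cell ns-blowup, seat instab, 2026-08-25)

The Jia–Šverák / Guillod–Šverák instability mechanism (JS, J. Funct. Anal. 268 (2015) = arXiv
1306.2136, Thms. 5.1–5.2; GŠ, arXiv:1704.00560) and its certified instances (cell pub-nsjs;
Hou–Wang–Yang arXiv:2509.25116; Albritton–Brué–Colombo, Ann. of Math. 196 (2022) for the forced
problem) produce Leray–Hopf non-uniqueness from data with a scale-invariant `|x|⁻¹` tip at the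
origin (`JiaSverak2015.JS15Datum`: `L²`, compactly supported, `|v₀(x)| ≤ C/|x|` near `0`) or
from a scale-critically singular force. The theorems below say exactly what such a mechanism
would have to deliver in order to bear on (A): non-uniqueness from a datum satisfying
Fefferman's (4). Guillod–Šverák themselves: "this conclusion may not apply to the problem of
singularity formation from smooth data … our results say nothing about it. However, if a
singularity is formed, our results suggest that, quite likely, uniqueness may be lost"
(arXiv:1704.00560, §1, p. 5). Nothing here asserts non-uniqueness of anything.

## References

* T. Tao, *Localisation and compactness properties of the Navier–Stokes global regularity
  problem*, Anal. PDE 6 (2013) 25–107 = arXiv:1108.1165: Lemma 8.1, Cor. 11.1, Remark 11.2.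
* J. Serrin, *The initial value problem for the Navier–Stokes equations*, in: Nonlinear Problems
  (Madison 1962), Univ. Wisconsin Press 1963, Thm. 6; G. Prodi, Ann. Mat. Pura Appl. 48 (1959).
* J. C. Robinson, J. L. Rodrigo, W. Sadowski, *The Three-Dimensional Navier–Stokes Equations*,
  CUP 2016, Thm. 8.19 (weak–strong uniqueness), Def. 4.9.
* C. L. Fefferman, *Existence and smoothness of the Navier–Stokes equation*, Clay Mathematics
  Institute (2000/2006), statements (A), (C) and conditions (4), (7).
* J. Guillod, V. Šverák, *Numerical investigations of non-uniqueness for the Navier–Stokes initial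
  value problem in borderline spaces*, arXiv:1704.00560 (2017) = J. Math. Fluid Mech. 25 (2023),
  §1 p. 5 (`GuillodSverak2023`).
-/

noncomputable section

open MeasureTheory Set Filter Topology
open scoped ENNReal NNReal ContDiff

namespace Literature.Analysis.FluidPDE

variable {ν T : ℝ} {u₀ : EuclideanSpace ℝ (Fin 3) → EuclideanSpace ℝ (Fin 3)}
  {U v : ℝ → EuclideanSpace ℝ (Fin 3) → EuclideanSpace ℝ (Fin 3)}
  {P : ℝ → EuclideanSpace ℝ (Fin 3) → ℝ}

/-- A solution in the class of Fefferman's (A) — the wave-0 predicate `IsNavierStokesSolution`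
with `U`, `P` jointly smooth on `[0, ∞) × ℝ³` — restricts to a classical solution
(`IsClassicalNSSolutionOn`) on every closed slab `[0, T]`, `T > 0` (field-by-field bridge
`isNavierStokesSolution_and_smooth_iff`, then `IsClassicalNSSolutionOn.mono`): Fefferman's (1), (2), (6) read on the
slab. [cite: Fefferman2000, (1)–(3) and (6)] -/
theorem IsNavierStokesSolution.isClassicalNSSolutionOn_Icc {f : ℝ → EuclideanSpace ℝ (Fin 3) → EuclideanSpace ℝ (Fin 3)}
    (hns : IsNavierStokesSolution ν f u₀ U P) (hU : IsSmoothOnHalfSpace U)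
    (hP : IsSmoothOnHalfSpace P) (hT : 0 < T) : IsClassicalNSSolutionOn (Icc 0 T) ν f U P :=
  (isNavierStokesSolution_and_smooth_iff.1 ⟨hns, hU, hP⟩).1.mono (fun _ hs => hs.1)
    (uniqueDiffOn_Icc hT)

/-- **Clay-class solutions are unique within the Leray–Hopf class** (Tao 2013, Lemma 8.1 and
Cor. 11.1, with Prodi–Serrin weak–strong uniqueness; all inputs are theorems of the tree). Let
`ν > 0`, `T > 0`, let `u₀` have rapidly decaying derivatives of all orders (Fefferman (4)), and
let `(U, P)` be jointly smooth on `[0, ∞) × ℝ³`, solve the unforced Navier–Stokes system with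
datum `u₀`, and have bounded energy (Fefferman (1)–(3), (6), (7)). Then every Leray–Hopf weak
solution `v` on `[0, T)` with viscosity `ν`, zero force and datum `u₀` satisfies `v(t) = U(t)`
a.e. for every `t ∈ (0, T]`. Proof: `U|[0,T]` is a finite energy classical solution, hence
Leray–Hopf from `U 0 = u₀` (`isLerayHopfOn_of_finiteEnergy`, Tao Lemma 8.1) and in
`L^∞((0,T); L^∞)` (`tao2011_hasBoundedSobolevNormsOn.closedSlab`, Tao Cor. 11.1 + Sobolev);
conclude by `weak_strong_uniqueness_holds` with `q = r = ∞`. [cite: Tao2011, Lemma 8.1 and Cor. 11.1 (arXiv:1108.1165)] [cite: RobinsonRodrigoSadowski2016, Thm. 8.19] -/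
theorem IsNavierStokesSolution.ae_eq_of_isLerayHopfOn (hν : 0 < ν) (hT : 0 < T)
    (hdec : HasRapidSpatialDecay u₀) (hns : IsNavierStokesSolution ν 0 u₀ U P)
    (hU : IsSmoothOnHalfSpace U) (hP : IsSmoothOnHalfSpace P) (hE : HasBoundedEnergy U)
    (hv : IsLerayHopfOn T ν 0 u₀ v) : ∀ t ∈ Ioc 0 T, v t =ᵐ[volume] U t := by
  have hcl : IsClassicalNSSolutionOn (Icc 0 T) ν 0 U P := hns.isClassicalNSSolutionOn_Icc hU hP hT
  have h0 : U 0 = u₀ := hns.initial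
  have hfe : ∃ A : ℝ≥0∞, A < ⊤ ∧ ∀ t ∈ Icc 0 T, ∫⁻ x, ‖U t x‖ₑ ^ 2 ≤ A := by
    obtain ⟨C, hC, hb⟩ := hE
    exact ⟨C, hC, fun t ht => hb t ht.1⟩
  have hdec0 : HasRapidSpatialDecay (U 0) := by
    rw [h0]
    exact hdec
  -- Tao 2013, Lemma 8.1: the finite energy classical solution `U` is Leray–Hopf on `[0, T)`
  have hLH : IsLerayHopfOn T ν 0 u₀ U := by
    have h := (isLerayHopfOn_of_finiteEnergy hcl hν hT hfe).1
    rwa [h0] at h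
  -- Tao 2013, Cor. 11.1 (+ Sobolev imbedding): `U ∈ L^∞((0, T); L^∞(ℝ³))`
  have hS : MemLqLp ⊤ ⊤ U (Ioo 0 T) :=
    (tao2011_hasBoundedSobolevNormsOn.closedSlab tao2011_hasBoundedSobolevNormsOn_holds
      linfty_bound_of_hasBoundedSobolevNormsOn_holds ν T hν hT U P hcl hfe hdec0).2
  -- Prodi–Serrin weak–strong uniqueness at the endpoint `q = r = ∞` (`2/∞ + 3/∞ = 0 ≤ 1`)
  have hr : (3 : ℝ≥0∞) < ⊤ := by simp
  have hqr : (2 : ℝ≥0∞) / ⊤ + 3 / ⊤ ≤ 1 := by simp [ENNReal.div_top]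
  exact weak_strong_uniqueness_holds hν hT hLH hr hqr hS hv

/-- **Two global Leray–Hopf solutions from one Clay datum agree at every positive time with any
Clay-class solution, hence with each other.** [cite: Tao2011, Lemma 8.1 and Cor. 11.1 (arXiv:1108.1165)] -/
theorem IsNavierStokesSolution.ae_eq_of_isGlobalLerayHopf (hν : 0 < ν)
    (hdec : HasRapidSpatialDecay u₀) (hns : IsNavierStokesSolution ν 0 u₀ U P)
    (hU : IsSmoothOnHalfSpace U) (hP : IsSmoothOnHalfSpace P) (hE : HasBoundedEnergy U)
    {u : ℝ → EuclideanSpace ℝ (Fin 3) → EuclideanSpace ℝ (Fin 3)} (hu : IsGlobalLerayHopf ν 0 u₀ u)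
    (hv : IsGlobalLerayHopf ν 0 u₀ v) {t : ℝ} (ht : 0 < t) : u t =ᵐ[volume] v t :=
  (hns.ae_eq_of_isLerayHopfOn hν ht hdec hU hP hE (hu t ht) t ⟨ht, le_rfl⟩).trans
    (hns.ae_eq_of_isLerayHopfOn hν ht hdec hU hP hE (hv t ht) t ⟨ht, le_rfl⟩).symm

/-- **Leray–Hopf non-uniqueness from a Clay datum excludes a Clay-class solution** (the typed
"instability ⇒ singularity" bridge; contrapositive of `ae_eq_of_isGlobalLerayHopf`). Let `ν > 0`
and let `u₀` have rapidly decaying derivatives of all orders. If `u₀` admits two global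
Leray–Hopf weak solutions `u`, `v` of the unforced system that differ on a set of positive
measure at some time `t > 0`, then there is NO pair `(U, P)` jointly smooth on `[0, ∞) × ℝ³`
solving the system with datum `u₀` with bounded energy — i.e. the conclusion of Fefferman's (A)
fails for `(ν, u₀)`. What is NOT asserted: that such `u₀`, `u`, `v` exist (for Clay data this
is at least as strong as finite-time blow-up: while a smooth solution exists every Leray–Hopf
solution equals it); the Jia–Šverák/Guillod–Šverák/Hou–Wang–Yang data are NOT of this class
(they carry an `|x|⁻¹` tip). [cite: Tao2011, Lemma 8.1 and Cor. 11.1 (arXiv:1108.1165)] [cite: GuillodSverak2023, §1 p. 5 (arXiv:1704.00560)] -/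
theorem not_exists_claySolution_of_lerayHopf_nonunique (hν : 0 < ν)
    (hdec : HasRapidSpatialDecay u₀) {u : ℝ → EuclideanSpace ℝ (Fin 3) → EuclideanSpace ℝ (Fin 3)}
    (hu : IsGlobalLerayHopf ν 0 u₀ u) (hv : IsGlobalLerayHopf ν 0 u₀ v) {t : ℝ} (ht : 0 < t)
    (hne : ¬ (u t =ᵐ[volume] v t)) :
    ¬ ∃ (U : ℝ → EuclideanSpace ℝ (Fin 3) → EuclideanSpace ℝ (Fin 3))
        (P : ℝ → EuclideanSpace ℝ (Fin 3) → ℝ),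
        IsSmoothOnHalfSpace U ∧ IsSmoothOnHalfSpace P ∧ IsNavierStokesSolution ν 0 u₀ U P ∧
          HasBoundedEnergy U := by
  rintro ⟨U, P, hUs, hPs, hns, hE⟩
  exact hne (hns.ae_eq_of_isGlobalLerayHopf hν hdec hUs hPs hE hu hv ht)

/-- **Under Clay (A), Leray–Hopf solutions from Clay data are unique at all positive times.**
The hypothesis `hA` is Fefferman's statement (A) written out verbatim over the wave-0
vocabulary — literally the body of `Literature.NS.NavierStokesExistenceSmoothR3`
(= the summit statement `NavierStokesRegularity`, `Summits/NavierStokesRegularity/…/Statement.lean`,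
not importable into `Literature/`); summit-side the instantiation is the one-liner
`lerayHopf_unique_of_clayA (hA := h)`. Consequently Leray–Hopf NON-uniqueness from a single
Clay datum refutes (A): this is the exact price tag on any "instability ⇒ singularity" route.
[cite: Tao2011, Lemma 8.1 and Cor. 11.1 (arXiv:1108.1165)] [cite: Fefferman2000, statement (A) with (4), (7)] -/
theorem lerayHopf_unique_of_clayA
    (hA : ∀ ν : ℝ, 0 < ν → ∀ u₀ : EuclideanSpace ℝ (Fin 3) → EuclideanSpace ℝ (Fin 3),
      ContDiff ℝ ∞ u₀ → NSWave0.IsDivFree u₀ → HasRapidSpatialDecay u₀ →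
        ∃ (u : ℝ → EuclideanSpace ℝ (Fin 3) → EuclideanSpace ℝ (Fin 3))
          (p : ℝ → EuclideanSpace ℝ (Fin 3) → ℝ),
          IsSmoothOnHalfSpace u ∧ IsSmoothOnHalfSpace p ∧ IsNavierStokesSolution ν 0 u₀ u p ∧
            HasBoundedEnergy u)
    (hν : 0 < ν) (hsm : ContDiff ℝ ∞ u₀) (hdiv : NSWave0.IsDivFree u₀)
    (hdec : HasRapidSpatialDecay u₀) {u : ℝ → EuclideanSpace ℝ (Fin 3) → EuclideanSpace ℝ (Fin 3)}
    (hu : IsGlobalLerayHopf ν 0 u₀ u) (hv : IsGlobalLerayHopf ν 0 u₀ v) {t : ℝ} (ht : 0 < t) :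
    u t =ᵐ[volume] v t := by
  obtain ⟨U, P, hUs, hPs, hns, hE⟩ := hA ν hν u₀ hsm hdiv hdec
  exact hns.ae_eq_of_isGlobalLerayHopf hν hdec hUs hPs hE hu hv ht

/-- **Leray–Hopf non-uniqueness from a Clay datum is an instance of ns.S19.** A `C¹`, divergence-free
datum with rapidly decaying derivatives is in `L²` (Fefferman's decay (4) with `K = 4`; tree lemma
`HasRapidSpatialDecay.lintegral_enorm_iteratedFDeriv_sq_lt_top`, Tao 2013 §1 p. 3 "Schwartz data are
`H¹`") and weakly divergence-free (Gauss–Green, tree theorem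
`VectorCalculus.IsDivFree.isWeaklyDivFree_holds`); so two global Leray–Hopf solutions from it that differ
at a positive time witness `LerayHopfNonUniqueness` (ns.S19, Buckmaster–Vicol EMS Surv. 6, §8 Problem 9).
Together with `not_exists_claySolution_of_lerayHopf_nonunique` this places the hypothesis "Leray–Hopf
non-uniqueness from ONE Clay datum" above BOTH the negation of Fefferman's (A) for that datum and the
open problem ns.S19. Nothing is asserted to exist. [cite: Tao2011, §1 p. 3 (Schwartz ⊂ H¹) with Lemma 8.1] [cite: BuckmasterVicol2019, EMS Surv. Math. Sci. 6  §8  Problem 9] -/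
theorem lerayHopfNonUniqueness_of_clayDatum (hν : 0 < ν) (hC1 : ContDiff ℝ 1 u₀)
    (hdiv : NSWave0.IsDivFree u₀) (hdec : HasRapidSpatialDecay u₀)
    {u : ℝ → EuclideanSpace ℝ (Fin 3) → EuclideanSpace ℝ (Fin 3)} (hu : IsGlobalLerayHopf ν 0 u₀ u)
    (hv : IsGlobalLerayHopf ν 0 u₀ v) {t : ℝ} (ht : 0 < t) (hne : ¬ (u t =ᵐ[volume] v t)) :
    LerayHopfNonUniqueness := by
  have hL2 : MemLp u₀ 2 volume := by
    have h0 := hdec.lintegral_enorm_iteratedFDeriv_sq_lt_top (μ := volume) 0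
    refine memLp_two_of_lintegral_lt_top hC1.continuous (lt_of_le_of_lt (le_of_eq ?_) h0)
    exact lintegral_congr fun x => by rw [← ofReal_norm, ← ofReal_norm, norm_iteratedFDeriv_zero]
  have hwdiv : IsWeaklyDivFree u₀ :=
    VectorCalculus.IsDivFree.isWeaklyDivFree_holds (fun x => hdiv x) hC1
  exact ⟨ν, hν, u₀, hL2, hwdiv, u, v, hu, hv, t, ht, hne⟩

/-- **The price tag, both sides at once.** For `ν > 0` and a smooth (`C^∞`), divergence-free datum `u₀`
with rapidly decaying derivatives, two global Leray–Hopf solutions that differ at some `t > 0` give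
simultaneously (i) the failure of the conclusion of Fefferman's (A) for `(ν, u₀)` and (ii) the open
statement ns.S19 `LerayHopfNonUniqueness`. (Conjunction of `not_exists_claySolution_of_lerayHopf_nonunique`
and `lerayHopfNonUniqueness_of_clayDatum`.) [cite: Tao2011, Lemma 8.1 and Cor. 11.1 (arXiv:1108.1165)] -/
theorem clayDatum_lerayHopf_nonunique_consequences (hν : 0 < ν) (hsm : ContDiff ℝ ∞ u₀)
    (hdiv : NSWave0.IsDivFree u₀) (hdec : HasRapidSpatialDecay u₀)
    {u : ℝ → EuclideanSpace ℝ (Fin 3) → EuclideanSpace ℝ (Fin 3)} (hu : IsGlobalLerayHopf ν 0 u₀ u)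
    (hv : IsGlobalLerayHopf ν 0 u₀ v) {t : ℝ} (ht : 0 < t) (hne : ¬ (u t =ᵐ[volume] v t)) :
    (¬ ∃ (U : ℝ → EuclideanSpace ℝ (Fin 3) → EuclideanSpace ℝ (Fin 3))
        (P : ℝ → EuclideanSpace ℝ (Fin 3) → ℝ),
        IsSmoothOnHalfSpace U ∧ IsSmoothOnHalfSpace P ∧ IsNavierStokesSolution ν 0 u₀ U P ∧
          HasBoundedEnergy U) ∧ LerayHopfNonUniqueness :=
  ⟨not_exists_claySolution_of_lerayHopf_nonunique hν hdec hu hv ht hne,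
    lerayHopfNonUniqueness_of_clayDatum hν (hsm.of_le (by norm_cast)) hdiv hdec hu hv ht hne⟩

end Literature.Analysis.FluidPDE

end
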